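import Summits.CriticalPhenomena.PercolationContinuityZ3.Theorems.PercNearOneGluingNoHeavyLowerTailKnQuestion8CoefficientwiseDisjointClusters
import HarnessLib

/-!
# NC* and NCA hold for every target set `W ⊇ V ∖ {x}`, on every finite multigraph (THEOREM CC in the NC* shape) — prim-lf-2 gen 65

Support file (`--supports stmt-CriticalPhenomena-4575`, closed), prover `prim-lf-2` (gen 65).  No definitions, no named facts, no sorries; standard axioms.
Memo `prim-lf-2/CW-NCA-gen63.md` §5c/§7 and `prim-lf-2/CW-NCSTAR-gen65.md` §1.

Setting (as in `…CoefficientwiseNCAGlue.lean`): a finite multigraph `ends : ι → Sym2 V`, an edge set `E₀` all of whose ends lie in a vertex finset `Vf`,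
a root `x`; colourings `s ⊆ E₀` (red) / `E₀ ∖ s` (blue); `K s = C_x(s) = openCluster (ends '' s) x`, `B s = K (E₀ ∖ s)`, core `Z_s = K s ∩ B s ∋ x`;
`T = (f (K s) − f (B s))(g (K s) − g (B s))` for monotone `f, g`.  CONJECTURE NC* (prim-lf-2 gen 63 — by `nca_glue`, `nca_elim_edge` and
`nca_of_multiTargetNoCore` the single statement the NO-CORE / `(I1)` / `A₀₀` / NCA programme reduces to): `Σ_{s : Z_s ∩ W = ∅} T ≥ 0` for every `W`.
For `W ⊇ V ∖ {x}` the event `Z_s ∩ W = ∅` is `Z_s = {x}` ('trivial core', the TAME stratum of memo §5c), and the sum is prim-lf-2 gen 26's THEOREM CC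
(`cc_sum_nonneg`: regrouping into component cubes + Harris) with the weight `w ≡ 1`, resp. `w = 1{X ∩ M = ∅}` for the NCA shape.  So THEOREM CC is
exactly the case `W ⊇ V ∖ {x}` of NC*, on every multigraph; this file records it in the sum shapes used by the gen-63 NC*/NCA files (e.g. as input
`h₁`/`h₂` of `nca_glue` for blocks whose every non-root vertex is a target).
* `Coefficientwise.ncStar_of_trivialCore` — `0 ≤ Σ_{s ⊆ E₀ : ∀ w ∈ W, ¬(w ∈ K s ∧ w ∈ B s)} T` whenever `∀ w ≠ x, w ∈ W`.
* `Coefficientwise.nca_of_trivialCore` — `0 ≤ Σ_{s ⊆ E₀ : (∀ v ∈ X, v ∉ K s ∧ v ∉ B s) ∧ (∀ w ∈ W, ¬(w ∈ K s ∧ w ∈ B s))} T` for every `X`, whenever `∀ w ≠ x, w ∈ W`.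
[cite: KozmaNitzan2024, Questions 8–9 (§5.5 p. 36) (context: the Question-8 pocket covariance programme)]
-/

namespace Summit.CriticalPhenomena.PercolationContinuityZ3.Theorems

open Finset Literature.Probability.Percolation

namespace Coefficientwise

variable {ι V : Type*} [DecidableEq ι]

open Classical in
/-- **NC* for `W ⊇ V ∖ {x}` (THEOREM CC in NC* shape).**  If all ends of `E₀`-edges lie in `Vf` and every vertex other than the root `x` belongs to `W`,
then for all monotone `f, g`: `0 ≤ Σ_{s ⊆ E₀ : ∀ w ∈ W, ¬(w ∈ C_x s ∧ w ∈ C_x(E₀∖s))} (f (C_x s) − f (C_x(E₀∖s))) (g (C_x s) − g (C_x(E₀∖s)))`.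
[cite: KozmaNitzan2024, Questions 8–9 (§5.5 p. 36) (context)] -/
theorem ncStar_of_trivialCore (ends : ι → Sym2 V) (E₀ : Finset ι) (x : V) (Vf : Finset V) (hVf : ∀ i ∈ E₀, ∀ y ∈ ends i, y ∈ Vf)
    (W : Set V) (hW : ∀ w, w ≠ x → w ∈ W) (f g : Set V → ℝ) (hf : Monotone f) (hg : Monotone g) :
    0 ≤ ∑ s ∈ E₀.powerset.filter (fun s : Finset ι =>
          ∀ w ∈ W, ¬ (w ∈ openCluster (ends '' (↑s : Set ι)) x ∧ w ∈ openCluster (ends '' (↑(E₀ \ s) : Set ι)) x)),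
      (f (openCluster (ends '' (↑s : Set ι)) x) - f (openCluster (ends '' (↑(E₀ \ s) : Set ι)) x)) *
        (g (openCluster (ends '' (↑s : Set ι)) x) - g (openCluster (ends '' (↑(E₀ \ s) : Set ι)) x)) := by
  by_cases hxW : x ∈ W
  · -- the root is always in both clusters: the event is empty
    rw [Finset.sum_filter]
    refine Finset.sum_nonneg fun s _ => ?_
    rw [if_neg (fun h => h x hxW ⟨mem_openCluster_self _ x, mem_openCluster_self _ x⟩)]
  · have hcongr : ∀ s ∈ E₀.powerset,
        (∀ w ∈ W, ¬ (w ∈ openCluster (ends '' (↑s : Set ι)) x ∧ w ∈ openCluster (ends '' (↑(E₀ \ s) : Set ι)) x)) ↔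
        (∀ w, w ∈ openCluster (ends '' (↑s : Set ι)) x → w ∈ openCluster (ends '' (↑(E₀ \ s) : Set ι)) x → w = x) := by
      intro s _
      constructor
      · intro h w hw1 hw2
        by_contra hwx
        exact h w (hW w hwx) ⟨hw1, hw2⟩
      · rintro h w hw ⟨hw1, hw2⟩
        exact hxW ((h w hw1 hw2) ▸ hw)
    rw [Finset.filter_congr hcongr]
    have key := cc_sum_nonneg ends E₀ x Vf hVf (fun _ => (1 : ℝ)) (fun _ => zero_le_one) f g hf hg
    simp only [one_mul] at key
    -- (`cc_sum_nonneg` was stated with the classical `DecidableEq ι`; `convert` bridges the instances)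
    convert key

open Classical in
/-- **NCA for `W ⊇ V ∖ {x}` (THEOREM CC in NCA shape).**  If all ends of `E₀`-edges lie in `Vf` and every vertex other than the root `x` belongs to `W`,
then for every avoided set `X` and all monotone `f, g`:
`0 ≤ Σ_{s ⊆ E₀ : (∀ v ∈ X, v ∉ C_x s ∧ v ∉ C_x(E₀∖s)) ∧ (∀ w ∈ W, ¬(w ∈ C_x s ∧ w ∈ C_x(E₀∖s)))} (f (C_x s) − f (C_x(E₀∖s))) (g (C_x s) − g (C_x(E₀∖s)))`.
[cite: KozmaNitzan2024, Questions 8–9 (§5.5 p. 36) (context)] -/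
theorem nca_of_trivialCore (ends : ι → Sym2 V) (E₀ : Finset ι) (x : V) (Vf : Finset V) (hVf : ∀ i ∈ E₀, ∀ y ∈ ends i, y ∈ Vf)
    (X W : Set V) (hW : ∀ w, w ≠ x → w ∈ W) (f g : Set V → ℝ) (hf : Monotone f) (hg : Monotone g) :
    0 ≤ ∑ s ∈ E₀.powerset.filter (fun s : Finset ι =>
          (∀ v ∈ X, v ∉ openCluster (ends '' (↑s : Set ι)) x ∧ v ∉ openCluster (ends '' (↑(E₀ \ s) : Set ι)) x) ∧
          (∀ w ∈ W, ¬ (w ∈ openCluster (ends '' (↑s : Set ι)) x ∧ w ∈ openCluster (ends '' (↑(E₀ \ s) : Set ι)) x))),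
      (f (openCluster (ends '' (↑s : Set ι)) x) - f (openCluster (ends '' (↑(E₀ \ s) : Set ι)) x)) *
        (g (openCluster (ends '' (↑s : Set ι)) x) - g (openCluster (ends '' (↑(E₀ \ s) : Set ι)) x)) := by
  set K : Finset ι → Set V := fun s => openCluster (ends '' (↑s : Set ι)) x with hK
  set F : Finset ι → ℝ := fun s => (f (K s) - f (K (E₀ \ s))) * (g (K s) - g (K (E₀ \ s))) with hF
  change 0 ≤ ∑ s ∈ E₀.powerset.filter (fun s => (∀ v ∈ X, v ∉ K s ∧ v ∉ K (E₀ \ s)) ∧ (∀ w ∈ W, ¬ (w ∈ K s ∧ w ∈ K (E₀ \ s)))), F s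
  by_cases hxW : x ∈ W
  · rw [Finset.sum_filter]
    refine Finset.sum_nonneg fun s _ => ?_
    rw [if_neg (fun h => h.2 x hxW ⟨mem_openCluster_self _ x, mem_openCluster_self _ x⟩)]
  · -- THEOREM CC with the weight `1{X ∩ M = ∅}`
    set w : Set V → ℝ := fun U => if (∀ v ∈ X, v ∉ U) then 1 else 0 with hw
    have hw0 : ∀ U, 0 ≤ w U := fun U => by simp only [hw]; split_ifs <;> norm_num
    have key0 := cc_sum_nonneg ends E₀ x Vf hVf w hw0 f g hf hg
    -- (`cc_sum_nonneg` was stated with the classical `DecidableEq ι`; `convert` bridges the instances)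
    have key : 0 ≤ ∑ s ∈ E₀.powerset.filter (fun s => ∀ y, y ∈ K s → y ∈ K (E₀ \ s) → y = x), w (K s ∪ K (E₀ \ s)) * F s := by
      convert key0
    -- `w · F` is `F` on the sub-event `X ∩ M = ∅` and `0` elsewhere
    have hwF : ∀ s, w (K s ∪ K (E₀ \ s)) * F s = if (∀ v ∈ X, v ∉ K s ∪ K (E₀ \ s)) then F s else 0 := by
      intro s; simp only [hw]; split_ifs <;> simp
    simp only [hwF] at key
    rw [← Finset.sum_filter, Finset.filter_filter] at key
    have hcongr : ∀ s ∈ E₀.powerset,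
        ((∀ v ∈ X, v ∉ K s ∧ v ∉ K (E₀ \ s)) ∧ (∀ w ∈ W, ¬ (w ∈ K s ∧ w ∈ K (E₀ \ s)))) ↔
        ((∀ y, y ∈ K s → y ∈ K (E₀ \ s) → y = x) ∧ (∀ v ∈ X, v ∉ K s ∪ K (E₀ \ s))) := by
      intro s _
      constructor
      · rintro ⟨hX, h⟩
        refine ⟨fun y hy1 hy2 => ?_, fun v hv hvM => ?_⟩
        · by_contra hyx
          exact h y (hW y hyx) ⟨hy1, hy2⟩
        · rcases hvM with hvM | hvM
          · exact (hX v hv).1 hvM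
          · exact (hX v hv).2 hvM
      · rintro ⟨h, hX⟩
        refine ⟨fun v hv => ⟨fun hvK => hX v hv (Or.inl hvK), fun hvB => hX v hv (Or.inr hvB)⟩, fun y hy ⟨hy1, hy2⟩ => ?_⟩
        exact hxW ((h y hy1 hy2) ▸ hy)
    rw [Finset.filter_congr hcongr]
    exact key

end Coefficientwise

end Summit.CriticalPhenomena.PercolationContinuityZ3.Theorems
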